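import Literature.Probability.LatticeModels.ScaleFrameRatioKernel
import HarnessLib

/-!
# Kesten's ratio forgetting along a scale frame: configuration surgeries (proved)

Topic `Literature/Probability/LatticeModels` (trunk `StatMech`, family `crit-ising`). The two
positivity inputs of the multi-level ratio-forgetting argument (H. Kesten, PTRF 73 (1986), §2,
proof of Thm. 3; D. Basu, A. Sapozhnikov, ECP 22 (2017), §2) on a `ScaleFrame`, obtained by editing
lattice configurations (every lattice configuration has positive mass for `0 < p < 1`; at `p = 0`
the inside pieces are null):

* `ScaleFrame.insidePiece_pos_of_walk` — BASE-WALK SURGERY: if two anchors `x, x'` are joined by a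
  walk of the frame graph through good vertices of radius `< b - η`, then the inside piece of a
  datum of the block `(b, bM^m)` is non-null for `x'` as soon as it is for `x` (add the walk's edges:
  the datum event is read on far edges, the inside path is prolonged inside `inSet b ⊆ U`).
* `ScaleFrame.exists_kernel_pos` — SEPARATOR SURGERY: if the inside piece of an outer datum `C`
  (block `(b', b'M^m)`, `b' = bM^{m+17+g}`) is non-null for `x ∈ inSet b`, then some inner datum `D`
  of the block `(b, bM^m)` has positive kernel `N(C, D) > 0` and non-null inside piece for `x`: add
  to a lattice configuration of the event an open separator of the sub-annulus `(bM, bM²)` (it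
  exists since `SepBound` makes the separator event non-null); the outer datum event and the inside
  piece survive, the inner rim of the new configuration is wired off the inside
  (`rimWiredOff_of_sepEvent`), and the chain decomposition `insidePiece_iff_of_nested_explEvent`
  exhibits the inner inside piece and the middle piece (`midPiece_iff_openCrossing`).

Everything is proved; no definitions.

## References
* [Kesten1986] H. Kesten, Probab. Theory Related Fields 73 (1986) 369–394, §2, proof of Thm. 3.
* [BasuSapozhnikov2017ECP] D. Basu, A. Sapozhnikov, ECP 22 (2017) no. 26, §2.
-/

open MeasureTheory Finset SimpleGraph
open Literature.Probability.Percolation (BondConfig openConnIn openCrossing explSet explRim explEvent)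

namespace Literature.Probability.LatticeModels

variable {V : Type*} [Fintype V] [DecidableEq V]

omit [Fintype V] [DecidableEq V] in
/-- Wiring off the inside implies wiring through the explored set (`openConnIn` is monotone in
its vertex set). [cite: BasuSapozhnikov2017ECP, §2, paragraph after eq. (2.3)] -/
private theorem wiredThrough_of_wiredOff {U In R : Set V} {ω : BondConfig V}
    (h : ∀ r ∈ R, ∀ r₂ ∈ R, ∃ v ∈ U \ In, ∃ v' ∈ U \ In,
      s(v, r) ∈ ω ∧ s(v', r₂) ∈ ω ∧ ω ∈ openConnIn (U \ In) v v') :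
    ∀ r ∈ R, ∀ r₂ ∈ R, ∃ v ∈ U, ∃ v' ∈ U,
      s(v, r) ∈ ω ∧ s(v', r₂) ∈ ω ∧ ω ∈ openConnIn U v v' := by
  intro r hr r₂ hr₂
  obtain ⟨v, hv, v', hv', h1, h2, h3⟩ := h r hr r₂ hr₂
  exact ⟨v, hv.1, v', hv'.1, h1, h2, Percolation.openConnIn_mono Set.sdiff_subset v v' h3⟩

/-- The inside piece misses the empty configuration (it asks for an open rim edge).
[cite: BasuSapozhnikov2017ECP, §2 (eq. (2.4)–(2.6))] -/
theorem ScaleFrame.empty_notMem_insidePiece (F : ScaleFrame V) (y : V) (U R : Set V) :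
    (∅ : BondConfig V) ∉ {ω : BondConfig V | ∃ w ∈ R, ∃ v ∈ U,
      ω ∩ (↑F.E : Set (Sym2 V)) ∈ openConnIn U y v ∧ s(v, w) ∈ ω ∩ (↑F.E : Set (Sym2 V))} := by
  rintro ⟨w, -, v, -, -, he⟩
  exact he.1

/-- **Base-walk surgery.** For the block `(b, bM^m)` explored from `inSet b` (`bM^m ≤ Rmax`,
`η ≤ b`, `M ≥ 4`, `m ≥ 1`) and two anchors joined by a walk of the frame graph through good vertices
of radius `< b - η`: if the inside piece of the datum `(U, R)` is non-null for the anchor `x`, it is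
non-null for `x'`. Take a lattice configuration of the event and open the walk's edges: the datum
event does not change (it is read on the pairs with good endpoints of radius `> b - η`,
`datumOff_iff_of_agree_far`), and the inside path from `x` is prolonged by the walk inside
`inSet b ⊆ U`. [cite: Kesten1986, §2, proof of Thm. 3] -/
theorem ScaleFrame.insidePiece_pos_of_walk (F : ScaleFrame V) (G : SimpleGraph V)
    [DecidableRel G.Adj] (hG : G = fromEdgeSet (↑F.E : Set (Sym2 V))) {p q b M : ℝ} {m : ℕ}
    (hp : p ∈ Set.Ico (0 : ℝ) 1) (hq : 0 < q) (hb : 0 < b) (hM : 4 ≤ M) (hm : 1 ≤ m)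
    (hη : F.η ≤ b) (hR : b * M ^ m ≤ F.Rmax) {x x' : V}
    (hw : ∃ w : G.Walk x x', ∀ z ∈ w.support, z ∈ F.good ∧ F.rad z < b - F.η) (U R : Set V) :
    let P := rcMeasure G p q ∅
    let Fd : Set (BondConfig V) := {ω | ω ∩ (↑F.E : Set (Sym2 V)) ∈
      explEvent (F.inSet b) (F.annSet b (b * M ^ m)) U R ∩
        {ω | ∀ r ∈ R, ∀ r₂ ∈ R, ∃ v ∈ U \ F.inSet b, ∃ v' ∈ U \ F.inSet b,
          s(v, r) ∈ ω ∧ s(v', r₂) ∈ ω ∧ ω ∈ openConnIn (U \ F.inSet b) v v'}}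
    let InP : V → Set (BondConfig V) := fun y =>
      {ω | ∃ w ∈ R, ∃ v ∈ U, ω ∩ (↑F.E : Set (Sym2 V)) ∈ openConnIn U y v ∧
        s(v, w) ∈ ω ∩ (↑F.E : Set (Sym2 V))}
    0 < P.real (Fd ∩ InP x) → 0 < P.real (Fd ∩ InP x') := by
  intro P Fd InP hpos
  classical
  have hp' : p ∈ Set.Icc (0 : ℝ) 1 := ⟨hp.1, hp.2.le⟩
  rcases hp.1.eq_or_lt with h0 | hp0
  · exfalso
    subst h0
    exact hpos.ne' (rcMeasure_real_eq_zero_of_p_eq_zero G hq ∅ fun h =>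
      F.empty_notMem_insidePiece x U R h.2)
  obtain ⟨ω, ⟨hFd, hIn⟩, hωG⟩ :=
    exists_subset_edgeSet_of_rcMeasure_real_ne_zero G hp' hq ∅ hpos.ne'
  obtain ⟨W, hW⟩ := hw
  have hη0 := F.η_pos
  -- open the walk's edges
  set ω' : BondConfig V := ω ∪ {e | e ∈ W.edges} with hω'
  have hω'G : ω' ⊆ G.edgeSet := Set.union_subset hωG fun e he => W.edges_subset_edgeSet he
  have hWsupp : ∀ e ∈ W.edges, ∃ z ∈ e, z ∈ W.support := by
    intro e he
    induction e using Sym2.ind with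
    | h u v => exact ⟨u, Sym2.mem_mk_left u v, W.fst_mem_support_of_mem_edges he⟩
  refine rcMeasure_real_pos_of_mem G hp0 hp.2 hq ∅ hω'G ⟨?_, ?_⟩
  · -- the datum event does not see the walk's edges
    refine (F.datumOff_iff_of_agree_far hb hM hm hη hR subset_rfl (ω₁ := ω) (ω₂ := ω')
      fun e _ hfar => ⟨fun h => Or.inl h, fun h => h.elim id fun heW => ?_⟩).1 hFd
    exfalso
    obtain ⟨z, hze, hzW⟩ := hWsupp e heW
    have h1 := (hfar z hze).2
    have h2 := (hW z hzW).2
    linarith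
  · -- prolong the inside path by the walk
    obtain ⟨w, hw, v, hv, hxv, hvw⟩ := hIn
    have e2 : ω ∩ (↑F.E : Set (Sym2 V)) = ω := inter_coe_eq_self_of_subset_edgeSet (hG ▸ hωG)
    have e2' : ω' ∩ (↑F.E : Set (Sym2 V)) = ω' := inter_coe_eq_self_of_subset_edgeSet (hG ▸ hω'G)
    rw [e2] at hxv hvw
    have hInU : F.inSet b ⊆ U := hFd.1.1 ▸ Percolation.subset_explSet _ _ _
    refine ⟨w, hw, v, hv, ?_, ?_⟩
    · rw [e2']
      have hx'x : ω' ∈ openConnIn U x' x :=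
        Percolation.mem_openConnIn_of_walk W.reverse
          (fun z hz => by
            rw [Walk.support_reverse, List.mem_reverse] at hz
            exact hInU ⟨(hW z hz).1, by linarith [(hW z hz).2]⟩)
          (fun e he => by
            rw [Walk.edges_reverse, List.mem_reverse] at he
            exact Or.inr he)
      exact Percolation.PlanarDuality.openConnIn_trans hx'x
        (Percolation.isUpperSet_openConnIn _ _ _ Set.subset_union_left hxv)
    · rw [e2']
      exact Or.inl hvw

/-- **Separator surgery: an outer datum with non-null inside piece has an inner datum with positive
kernel.** Inner block `(b, bM^m)` explored from `inSet b`, outer block `(b', b'M^m)`,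
`b' = bM^{m+17+g}` (`b'M^{m+1} ≤ Rmax`, `η ≤ b`, `M ≥ 4`, `m ≥ 2`, the separator bound for
`(bM, bM²)`), `x ∈ inSet b`. If `φ(Fd_{b'}(C) ∩ InP_x(C)) > 0` then for some inner datum
`D = (U_D, R_D)` both `φ(Fd_{b'}(C) ∩ Fd_b(D) ∩ {R_D ↔ R_C in (U_C ∪ R_C) ∖ U_D}) > 0` and
`φ(Fd_b(D) ∩ InP_x(D)) > 0`: to a lattice configuration `ω` of the event add an open separator `σ`
of `(bM, bM²)` (a lattice configuration of the non-null separator event); `ω ∪ σ` keeps the outer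
datum (far edges) and the inside piece (increasing), its inner datum `D` is wired off the inside
(`rimWiredOff_of_sepEvent`), and by the chain decomposition `insidePiece_iff_of_nested_explEvent`
it lies in the inner inside piece and in the middle piece, i.e. in the open crossing between the
rims (`midPiece_iff_openCrossing`). [cite: Kesten1986, §2, proof of Thm. 3] -/
theorem ScaleFrame.exists_kernel_pos (F : ScaleFrame V) (G : SimpleGraph V) [DecidableRel G.Adj]
    (hG : G = fromEdgeSet (↑F.E : Set (Sym2 V))) {p q c b b' M : ℝ} {m g : ℕ}
    (hp : p ∈ Set.Ico (0 : ℝ) 1) (hq : 1 ≤ q) (hc : 0 < c) (hb : 0 < b) (hM : 4 ≤ M) (hm : 2 ≤ m)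
    (hb' : b' = b * M ^ (m + 17 + g)) (hRmax : b' * M ^ (m + 1) ≤ F.Rmax) (hη : F.η ≤ b)
    (hsb : F.SepBound p q c (b * M ^ 1) (b * M ^ (1 + 1))) {x : V} (hx : x ∈ F.inSet b)
    (UC RC : Set V) :
    let P := rcMeasure G p q ∅
    let Fd : ℝ → Set V → Set V → Set (BondConfig V) := fun b₀ U R =>
      {ω | ω ∩ (↑F.E : Set (Sym2 V)) ∈ explEvent (F.inSet b₀) (F.annSet b₀ (b₀ * M ^ m)) U R ∩
        {ω | ∀ r ∈ R, ∀ r₂ ∈ R, ∃ v ∈ U \ F.inSet b₀, ∃ v' ∈ U \ F.inSet b₀,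
          s(v, r) ∈ ω ∧ s(v', r₂) ∈ ω ∧ ω ∈ openConnIn (U \ F.inSet b₀) v v'}}
    let InP : V → Set V → Set V → Set (BondConfig V) := fun y U R =>
      {ω | ∃ w ∈ R, ∃ v ∈ U, ω ∩ (↑F.E : Set (Sym2 V)) ∈ openConnIn U y v ∧
        s(v, w) ∈ ω ∩ (↑F.E : Set (Sym2 V))}
    0 < P.real (Fd b' UC RC ∩ InP x UC RC) →
      ∃ D : Finset V × Finset V,
        0 < P.real (Fd b' UC RC ∩ Fd b ↑D.1 ↑D.2 ∩ openCrossing ((UC ∪ RC) \ ↑D.1) ↑D.2 RC) ∧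
          0 < P.real (Fd b ↑D.1 ↑D.2 ∩ InP x ↑D.1 ↑D.2) := by
  intro P Fd InP hpos
  subst hb'
  classical
  have hp' : p ∈ Set.Icc (0 : ℝ) 1 := ⟨hp.1, hp.2.le⟩
  have hq0 : 0 < q := one_pos.trans_le hq
  have hη0 := F.η_pos
  have hm1 : 1 ≤ m := Nat.le_of_succ_le hm
  -- scales
  have hb'0 : 0 < b * M ^ (m + 17 + g) := by positivity
  have hbm : b ≤ b * M ^ m := by
    have h := scale_gap hb hM (Nat.lt_of_lt_of_le Nat.zero_lt_one hm1)
    rw [pow_zero, mul_one] at h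
    linarith
  have hsA : b * M ^ m + b ≤ b * M ^ (m + 17 + g) := scale_gap hb hM (by omega)
  have hsB : b * M ^ (m + 17 + g) ≤ b * M ^ (m + 17 + g) * M ^ (m + 1) :=
    le_mul_of_one_le_right hb'0.le (one_le_pow₀ (by linarith))
  have hsC : b * M ^ (m + 17 + g) * M ^ m ≤ b * M ^ (m + 17 + g) * M ^ (m + 1) :=
    scale_mono hb'0 hM (Nat.le_succ m)
  have hsD : b * M ^ (1 + 1) ≤ b * M ^ m := scale_mono hb hM (by omega)
  have hsE : b * M ^ m + b ≤ b * M ^ (m + 1) := scale_gap hb hM (Nat.lt_succ_self m)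
  have hsF : b * M ^ (m + 1) ≤ b * M ^ (m + 17 + g) := scale_mono hb hM (by omega)
  have hR'm : b * M ^ (m + 17 + g) * M ^ m ≤ F.Rmax := hsC.trans hRmax
  have hRm : b * M ^ m ≤ F.Rmax := by linarith
  have hRη : b * M ^ m + F.η ≤ F.Rmax := by linarith
  -- `p = 0` is impossible
  rcases hp.1.eq_or_lt with h0 | hp0
  · exfalso
    subst h0
    exact hpos.ne' (rcMeasure_real_eq_zero_of_p_eq_zero G hq0 ∅ fun h =>
      F.empty_notMem_insidePiece x UC RC h.2)
  obtain ⟨ω, ⟨hFdC, hIn⟩, hωG⟩ :=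
    exists_subset_edgeSet_of_rcMeasure_real_ne_zero G hp' hq0 ∅ hpos.ne'
  -- an open separator of the sub-annulus `(bM, bM²)`
  obtain ⟨σ, hσsep, hσG⟩ : ∃ σ ∈ F.sepEvent (b * M ^ 1) (b * M ^ (1 + 1)),
      σ ⊆ (fromEdgeSet (↑(F.edgesTouching (F.annSet (b * M ^ 1) (b * M ^ (1 + 1)))) :
        Set (Sym2 V))).edgeSet := by
    have h : c ≤ _ := hsb
    exact exists_subset_edgeSet_of_rcMeasure_real_ne_zero _ hp' hq0 ∅ (hc.trans_le h).ne'
  have hσE : ∀ e ∈ σ, e ∈ F.E ∧ (∃ v ∈ e, v ∈ F.annSet (b * M ^ 1) (b * M ^ (1 + 1))) ∧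
      ¬ e.IsDiag := fun e he => by
    have h := hσG he
    rw [edgeSet_fromEdgeSet] at h
    obtain ⟨h1, h2⟩ := h
    obtain ⟨heE, hv⟩ := F.mem_edgesTouching.1 (Finset.mem_coe.1 h1)
    exact ⟨heE, hv, h2⟩
  set ω' : BondConfig V := ω ∪ σ with hω'
  have hω'G : ω' ⊆ G.edgeSet := Set.union_subset hωG fun e he => by
    rw [hG, edgeSet_fromEdgeSet]
    exact ⟨Finset.mem_coe.2 (hσE e he).1, (hσE e he).2.2⟩
  have hω'F : ω' ⊆ F.graph.edgeSet := by
    rw [ScaleFrame.graph, ← hG]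
    exact hω'G
  have e2' : ω' ∩ (↑F.E : Set (Sym2 V)) = ω' := inter_coe_eq_self_of_subset_edgeSet (hG ▸ hω'G)
  -- (a) the outer datum survives (the separator's edges lie far below the outer block)
  have hFdC' : ω' ∈ Fd (b * M ^ (m + 17 + g)) UC RC := by
    refine (F.datumOff_iff_of_agree_far hb'0 hM hm1 (hη.trans (by linarith)) hR'm subset_rfl
      (ω₁ := ω) (ω₂ := ω') fun e _ hfar => ⟨fun h => Or.inl h, fun h => h.elim id fun heσ => ?_⟩).1
      hFdC
    exfalso
    obtain ⟨-, ⟨v, hv, -, -, hv2⟩, -⟩ := hσE e heσ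
    have h2 := (hfar v hv).2
    linarith
  -- (b) the inside piece survives (increasing)
  have hIn' : ω' ∈ InP x UC RC :=
    F.isUpperSet_insidePiece x UC RC (Set.subset_union_left : ω ⊆ ω') hIn
  -- (c) the inner datum of `ω'` is wired off the inside
  have hσ' : ω' ∈ F.sepEvent (b * M ^ 1) (b * M ^ (1 + 1)) :=
    F.isUpperSet_sepEvent _ _ (Set.subset_union_right : σ ⊆ ω') hσsep
  have hWoff := F.rimWiredOff_of_sepEvent hb hM (show 1 + 1 ≤ m by omega) hη hRη hω'F hσ'
  set UD : Set V := explSet (F.inSet b) (F.annSet b (b * M ^ m)) ω' with hUD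
  set RD : Set V := explRim (F.inSet b) (F.annSet b (b * M ^ m)) ω' with hRD
  have hED : ω' ∈ explEvent (F.inSet b) (F.annSet b (b * M ^ m)) UD RD :=
    Percolation.mem_explEvent_self _ _ ω'
  have hFdD : ω' ∈ Fd b UD RD := by
    simp only [Fd, Set.mem_setOf_eq, e2']
    exact ⟨hED, hWoff⟩
  -- (d) the chain decomposition of the outer inside piece at the nested inner datum
  have hEC : ω' ∈ explEvent (F.inSet (b * M ^ (m + 17 + g)))
      (F.annSet (b * M ^ (m + 17 + g)) (b * M ^ (m + 17 + g) * M ^ m)) UC RC := by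
    have h := hFdC'.1
    rw [e2'] at h
    exact h
  obtain ⟨hInUC, -, -, hRCU⟩ := F.datum_bounds hb'0 hM hm1 hR'm subset_rfl hFdC'.1
  obtain ⟨-, hUDb, hRDb, -⟩ := F.datum_bounds hb hM hm1 hRm subset_rfl hFdD.1
  have hUDC : UD ⊆ UC := fun v hv => hInUC ⟨(hUDb v hv).1, by linarith [(hUDb v hv).2]⟩
  have hRDC : RD ⊆ UC := fun r hr => hInUC ⟨(hRDb r hr).1, by linarith [(hRDb r hr).2.2]⟩
  have hRCD : ∀ r ∈ RC, r ∉ UD ∧ r ∉ RD := fun r hr =>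
    ⟨fun h => hRCU r hr (hUDC h), fun h => hRCU r hr (hRDC h)⟩
  have hxD : x ∈ UD := Percolation.subset_explSet _ _ _ hx
  have hIn'' : ∃ w ∈ RC, ∃ v ∈ UC, ω' ∈ openConnIn UC x v ∧ s(v, w) ∈ ω' := by
    obtain ⟨w, hw, v, hv, h1, h2⟩ := hIn'
    rw [e2'] at h1 h2
    exact ⟨w, hw, v, hv, h1, h2⟩
  obtain ⟨hInD, hMid⟩ := (insidePiece_iff_of_nested_explEvent hED (wiredThrough_of_wiredOff hWoff)
    hUDC hRDC hRCD hxD).1 hIn''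
  have hX : ω' ∈ openCrossing ((UC ∪ RC) \ UD) RD RC :=
    (midPiece_iff_openCrossing hEC hED hUDC hRDC).1 hMid
  -- (e) positivity at `ω'`
  refine ⟨((Set.toFinite UD).toFinset, (Set.toFinite RD).toFinset), ?_, ?_⟩
  · simp only [Set.Finite.coe_toFinset]
    exact rcMeasure_real_pos_of_mem G hp0 hp.2 hq0 ∅ hω'G ⟨⟨hFdC', hFdD⟩, hX⟩
  · simp only [Set.Finite.coe_toFinset]
    refine rcMeasure_real_pos_of_mem G hp0 hp.2 hq0 ∅ hω'G ⟨hFdD, ?_⟩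
    obtain ⟨w', hw', v', hv', h1, h2⟩ := hInD
    refine ⟨w', hw', v', hv', ?_, ?_⟩
    · rw [e2']
      exact h1
    · rw [e2']
      exact h2

end Literature.Probability.LatticeModels
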